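import Summits.CriticalPhenomena.PercolationContinuityZ3.Theorems.Transplant.FKConnectivityAllQApexStep
import HarnessLib

/-!
# Connectivity correlation inequalities for `φ_{w,q}`, every `q > 0` — file 9e: NEGATIVE ASSOCIATION ON 2-TREE (SERIES–PARALLEL)
# SUPPORTS FOR `0 < q ≤ 1` (Wagner 2008, kernel proof) AND THE UNCONDITIONAL HUB INEQUALITY FOR `q < 1` ON THOSE SUPPORTS

Support file (`--supports stmt-CriticalPhenomena-4575`), FK sub-lane `prim-bschramm-fk-1` (gen 5) of the post-continuity
programme; builds on p205010 (kernel theorem, internal audit signed; external expert review pending).  Definitions: `IsTwoTree`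
(2-trees as edge sets) and `EdgeNegCorrSupp` (edge-negative association for every weight vector supported in a given edge set —
the hypothesis shape of `pairConnPosUnder_of_edgeNegCorr_on`).  No named facts, no sorries; standard axioms.

THE ARGUMENT (files `…ApexTools`, `…ApexMass`, `…ApexCases`, `…ApexStep`, `…TwoTree`).  Wagner (Ann. Comb. 2008, Ex. 5.1 +
Thm. 5.8(d) + §5.3) proves that the random-cluster (Potts) model with `0 < q ≤ 1` is Rayleigh — edge-negatively associated,
`φ(J_e ∩ J_f) ≤ φ(J_e)φ(J_f)` (Grimmett 2006 §3.9 (3.94)) — on every series–parallel graph, by induction over two-sums.  We prove the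
graph case by APEX ELIMINATION over 2-trees (whose subgraphs are exactly the series–parallel = `K₄`-minor-free graphs): a 2-tree
is `{uv}` or `T ∪ {ux, xv}` with `uv ∈ T` and `x` fresh; for a weight vector `w` supported in `T ∪ {ux, xv}` write `a = ux`,
`b = xv`, `g = uv`, `w° = w[a↦0][b↦0]` and `K' = {u ↔ v avoiding a, b}`.  Three exact identities for events `F` insensitive to
`a, b` (file `…ApexMass`): `S_w(F) = ((1−p_a)+p_a q⁻¹)((1−p_b)+p_b q⁻¹)·S°(F) − p_a p_b q⁻¹(q⁻¹−1)·S°(F ∩ K')`,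
`S_w(J_b ∩ F ∩ K') = p_b q⁻¹·S°(F ∩ K')`, `S_w(J_a ∩ J_b ∩ F) = p_a p_b (q⁻¹ S°(F) + (q⁻¹−1)q⁻¹ S°(F ∩ K'ᶜ))`.  With fk-2's
master identity (`negCorr_defect_eq`: `Cov(J_e, J_f) ≤ 0 ⟺` opening `f` does not lower `φ_{w[e↦0]}(x ↔ y)`, `e = xy`) every pair
reduces to EC⁺ for `u ↔ v` one level down, i.e. to negative association on `T` (file `…ApexCases`): `(a, f)`:
`φ_{w[a↦0][f↦s]}(u ↔ x) = θ·φ_{w°[f↦s]}(u ↔ v)`; `(g, f)`: `φ_{w[g↦0][f↦s]}(u ↔ v)` is an increasing Möbius function of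
`φ_{w°[g↦0][f↦s]}(u ↔ v)`; `(a, b)`, `(a, g)`: unconditional; and pairs `e, f ⊆ T ∖ g` are MARGINALISED (file `…ApexStep`):
`S_w(E) = α·S_{w°[g↦c]}(E)` for `E ∈ {J_e ∩ J_f, J_e, J_f, Ω}` with `α = (1−p_a)(1−p_b) + (p_a+p_b−p_ap_b)q⁻¹` and
`α c = α p_g + (1−p_g)p_a p_b q⁻¹` (the path `u–x–v` is a pair `uv` in parallel with `g`).

RESULTS:
* **`FK.edgeNegCorrSupp_of_isTwoTree`** — for `0 < q ≤ 1` and every 2-tree `T`, every `φ_{w,q}` with `supp w ⊆ T` is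
  edge-negatively associated.  This PROVES, on supports presented inside a 2-tree, the statement recorded as the named fact
  `Wagner2008_rc_edgeNegCorr_of_noK4Minor` (`Literature/Probability/LatticeModels/RandomClusterRayleighSeriesParallel.lean`;
  `rc_edgeNegCorr_of_isTwoTree` has that fact's shape with '`K₄`-minor-free' replaced by 'inside a 2-tree'); the purely
  graph-theoretic identification 'simple `K₄`-minor-free graphs = subgraphs of 2-trees' (Dirac 1952, Duffin 1965, Wald–Colbourn
  1983) is not formalised here.
* **`FK.pairConnPosUnder_of_isTwoTree`, `FK.hubUnder_of_isTwoTree`** — for every `q ∈ (0,1)`: pairwise positive correlation of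
  connection events, in particular Ayyer–Linusson–Ravichandran's hub inequality (13) `φ(o ↔ a)φ(b ↔ a) ≤ φ(o ↔ a ↔ b)`, for every
  weight vector supported in a 2-tree containing the two pairs — UNCONDITIONAL (fk-2's `…AllQSeriesParallel` versions assume the
  named fact).  ALR (arXiv:2509.18788, §7) prove (13) for the arboreal gas on outerplanar graphs (Thm. 5.3) and state it as open in
  general ('even for the arboreal gas'); as far as searched (corpus + galaxy + desk S133/S136) the `q < 1` random-cluster statement
  on all series–parallel supports is not in print as a theorem, though it follows from Wagner 2008 + the lane's reduction.
[cite: Wagner2006, Ex. 5.1, Thm. 5.8(d), §5.3] [cite: AyyerLinussonRavichandran2025, §7 eq. (13)–(15), Conj. 7.1, Thm. 5.3 (p. 22)]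
[cite: Grimmett2006, §3.9 eq. (3.94) (pp. 63–64)]
-/

noncomputable section

namespace Summit.CriticalPhenomena.PercolationContinuityZ3.Theorems

namespace FK

open MeasureTheory Set Literature.Probability.LatticeModels Literature.Probability.Percolation
open Literature.Probability.Percolation.DecisionTree (ind ind_of_mem ind_of_not_mem ind_nonneg)
open Literature.Probability.Percolation.TwoAvoidanceSets (ind_mul_ind)
open scoped Classical symmDiff

variable {V : Type*} [Fintype V]

/-! ### 2-trees (as edge sets) and negative association on a support -/

/-- **2-trees as edge sets**: the single pair `{uv}` (`u ≠ v`) is a 2-tree, and if `T` is a 2-tree containing the pair `uv`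
and `x` is a vertex not covered by `T`, then `T ∪ {ux, xv}` is a 2-tree.  The subgraphs of 2-trees (partial 2-trees) are exactly
the finite simple graphs with no `K₄` minor, i.e. the series–parallel graphs (Wald–Colbourn 1983; Duffin 1965; Dirac 1952) —
that identification is not formalised here. [cite: Wagner2006, §5.3] -/
inductive IsTwoTree : Set (Sym2 V) → Prop
  | pair {u v : V} (huv : u ≠ v) : IsTwoTree {s(u, v)}
  | cons {T : Set (Sym2 V)} {u v x : V} (hT : IsTwoTree T) (huv : s(u, v) ∈ T) (hx : ∀ e ∈ T, x ∉ e) :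
      IsTwoTree (T ∪ {s(u, x), s(x, v)})

/-- **Edge-negative association of `φ_{w,q}` for every weight vector supported in the edge set `S`** (Grimmett 2006 §3.9 (3.94)
restricted to a support): `φ_w(J_e ∩ J_f) ≤ φ_w(J_e)·φ_w(J_f)` for all `w` with `{e | w e ≠ 0} ⊆ S`, all non-loop pairs `e` and all
`f ≠ e` — the hypothesis shape of `pairConnPosUnder_of_edgeNegCorr_on`. [cite: Grimmett2006, §3.9 eq. (3.94) (p. 63)] -/
def EdgeNegCorrSupp (S : Set (Sym2 V)) (q : ℝ) : Prop :=
  ∀ w : Sym2 V → unitInterval, (∀ e, ((w e : unitInterval) : ℝ) ≠ 0 → e ∈ S) → ∀ e f : Sym2 V, ¬ e.IsDiag → f ≠ e →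
    (rcMeasureW w q ∅).real ({ω | e ∈ ω} ∩ {ω | f ∈ ω}) ≤
      (rcMeasureW w q ∅).real {ω | e ∈ ω} * (rcMeasureW w q ∅).real {ω | f ∈ ω}

omit [Fintype V] in
/-- 2-trees have no loops. [folklore] -/
theorem IsTwoTree.not_isDiag {T : Set (Sym2 V)} (hT : IsTwoTree T) {e : Sym2 V} (he : e ∈ T) : ¬ e.IsDiag := by
  induction hT with
  | pair huv =>
    rw [Set.mem_singleton_iff] at he
    subst he
    rwa [Sym2.mk_isDiag_iff]
  | @cons T u v x hT' huvT hx ih =>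
    rcases he with he | he
    · exact ih he
    · have hxu : x ≠ u := fun h => hx _ huvT (h ▸ Sym2.mem_mk_left u v)
      have hxv : x ≠ v := fun h => hx _ huvT (h ▸ Sym2.mem_mk_right u v)
      rcases he with rfl | rfl
      · rw [Sym2.mk_isDiag_iff]; exact hxu.symm
      · rw [Sym2.mk_isDiag_iff]; exact hxv

/-! ### The theorem: negative association on 2-tree supports, and the unconditional hub inequality -/

/-- **Wagner's theorem (graph case) on 2-tree supports — kernel proof.**  For `0 < q ≤ 1` and every weight vector `w`
supported in a 2-tree `T`, the random-cluster measure `φ_{w,q}` is edge-negatively associated: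
`φ(J_e ∩ J_f) ≤ φ(J_e)·φ(J_f)` for all non-loop `e` and all `f ≠ e`.  Proof by apex elimination (`edgeNegCorr_supp_apex_step`),
a vertex-level form of Wagner's two-sum induction (Ann. Comb. 2008, Thm. 5.8(d) with Ex. 5.1); `q = 1` is the product measure.
Subgraphs of 2-trees are exactly the finite series–parallel (`K₄`-minor-free) graphs, so this proves the named fact
`Wagner2008_rc_edgeNegCorr_of_noK4Minor` on every support that is presented inside a 2-tree (the graph-theoretic identification
'no `K₄` minor ⟺ partial 2-tree' is not formalised). [cite: Wagner2006, Ex. 5.1, Thm. 5.8(d), §5.3]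
[cite: Grimmett2006, §3.9 eq. (3.94) (pp. 63–64)] -/
theorem edgeNegCorrSupp_of_isTwoTree {q : ℝ} (hq0 : 0 < q) (hq1 : q ≤ 1) {T : Set (Sym2 V)} (hT : IsTwoTree T) :
    EdgeNegCorrSupp T q := by
  rcases hq1.lt_or_eq with hlt | rfl
  · induction hT with
    | pair huv => exact edgeNegCorr_supp_pair hq0 _
    | cons hT' huvT hx ih => exact edgeNegCorr_supp_apex_step hq0 hlt (fun e he => hT'.not_isDiag he) huvT hx ih
  · intro w _ e f _ hfe
    exact negCorr_of_q_one w e f hfe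

/-- **Pairwise positive correlation of connection events on 2-tree (series–parallel) supports, every `q ∈ (0,1)` —
UNCONDITIONAL**: if `w` is supported in a 2-tree `T` containing the pairs `xy` and `uv`, then
`φ_{w,q}(x ↔ y)·φ_{w,q}(u ↔ v) ≤ φ_{w,q}(x ↔ y, u ↔ v)`.  (fk-2's `pairConnPosUnder_of_noK4Minor` assumed Wagner's theorem as a
named fact; here it is proved.) [cite: AyyerLinussonRavichandran2025, §7 eq. (13)–(15), (19) (pp. 22–27)] [cite: Wagner2006, Thm. 5.8(d), §5.3] -/
theorem pairConnPosUnder_of_isTwoTree {q : ℝ} (hq0 : 0 < q) (hq1 : q < 1) {T : Set (Sym2 V)} (hT : IsTwoTree T)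
    {x y u v : V} (hxy : s(x, y) ∈ T) (huv : s(u, v) ∈ T) (w : Sym2 V → unitInterval)
    (hw : ∀ e, ((w e : unitInterval) : ℝ) ≠ 0 → e ∈ T) : PairConnPosUnder (rcMeasureW w q ∅) x y u v :=
  pairConnPosUnder_of_edgeNegCorr_on hq0 hq1 T (edgeNegCorrSupp_of_isTwoTree hq0 hq1.le hT) x y u v hxy huv w hw

/-- **The hub inequality (Ayyer–Linusson–Ravichandran 2025, (13)) on 2-tree (series–parallel) supports, every `q ∈ (0,1)` —
UNCONDITIONAL**: if `w` is supported in a 2-tree `T ∋ oa, ba`, then `φ_{w,q}(o ↔ a)·φ_{w,q}(b ↔ a) ≤ φ_{w,q}(o ↔ a ↔ b)`.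
ALR prove (13) for the arboreal gas on outerplanar graphs (their Thm. 5.3) and list it as open in general; this is the
random-cluster `q < 1` statement on all series–parallel supports, now a kernel theorem with no named-fact hypothesis.
[cite: AyyerLinussonRavichandran2025, §7 eq. (13), Conj. 7.1, Thm. 5.3 (p. 22)] [cite: Wagner2006, Thm. 5.8(d), §5.3] -/
theorem hubUnder_of_isTwoTree {q : ℝ} (hq0 : 0 < q) (hq1 : q < 1) {T : Set (Sym2 V)} (hT : IsTwoTree T)
    {o a b : V} (hoa : s(o, a) ∈ T) (hba : s(b, a) ∈ T) (w : Sym2 V → unitInterval)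
    (hw : ∀ e, ((w e : unitInterval) : ℝ) ≠ 0 → e ∈ T) : HubUnder (rcMeasureW w q ∅) o a b :=
  hubUnder_of_edgeNegCorr_on hq0 hq1 T (edgeNegCorrSupp_of_isTwoTree hq0 hq1.le hT) o a b hoa hba w hw

/-- **The named fact's conclusion on 2-tree supports** (`Fin n` form of `Wagner2008_rc_edgeNegCorr_of_noK4Minor`, with the
`K₄`-minor-freeness hypothesis replaced by presentation inside a 2-tree): for `0 < q ≤ 1`, every `n`, every 2-tree `T` on `Fin n`
and every `w` with `{e | w e ≠ 0} ⊆ T`, `φ_{w,q}(J_e ∩ J_f) ≤ φ_{w,q}(J_e)φ_{w,q}(J_f)` for `e` not a loop and `f ≠ e`.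
[cite: Wagner2006, Ex. 5.1, Thm. 5.8(d), §5.3] [cite: Grimmett2006, §3.9 eq. (3.94) (p. 63)] -/
theorem rc_edgeNegCorr_of_isTwoTree (n : ℕ) (w : Sym2 (Fin n) → unitInterval) (q : ℝ) (hq0 : 0 < q) (hq1 : q ≤ 1)
    {T : Set (Sym2 (Fin n))} (hT : IsTwoTree T) (hw : {e : Sym2 (Fin n) | ((w e : unitInterval) : ℝ) ≠ 0} ⊆ T) :
    ∀ e f : Sym2 (Fin n), ¬ e.IsDiag → f ≠ e →
      (rcMeasureW w q ∅).real ({ω | e ∈ ω} ∩ {ω | f ∈ ω}) ≤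
        (rcMeasureW w q ∅).real {ω | e ∈ ω} * (rcMeasureW w q ∅).real {ω | f ∈ ω} :=
  edgeNegCorrSupp_of_isTwoTree hq0 hq1 hT w fun _ he => hw he

/-- Negative association on a support is inherited by smaller supports. [cite: Grimmett2006, §3.9 eq. (3.94) (p. 63)] -/
theorem EdgeNegCorrSupp.mono {S T : Set (Sym2 V)} {q : ℝ} (hST : S ⊆ T) (hT : EdgeNegCorrSupp T q) : EdgeNegCorrSupp S q :=
  fun w hw => hT w (fun e' he' => hST (hw e' he'))

/-- **Negative association on every PARTIAL 2-tree** (`0 < q ≤ 1`): if the edge set `S` lies inside some 2-tree, every `φ_{w,q}`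
with `supp w ⊆ S` is edge-negatively associated.  (Partial 2-trees = finite series–parallel = `K₄`-minor-free graphs.)
[cite: Wagner2006, Ex. 5.1, Thm. 5.8(d), §5.3] [cite: Grimmett2006, §3.9 eq. (3.94) (p. 63)] -/
theorem edgeNegCorrSupp_of_subset_twoTree {q : ℝ} (hq0 : 0 < q) (hq1 : q ≤ 1) {S T : Set (Sym2 V)} (hT : IsTwoTree T)
    (hST : S ⊆ T) : EdgeNegCorrSupp S q :=
  EdgeNegCorrSupp.mono hST (edgeNegCorrSupp_of_isTwoTree hq0 hq1 hT)

/-! ### Examples of 2-trees: triangles (so the theorems above are not vacuous) -/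

omit [Fintype V] in
/-- The triangle `{uv, uw, wv}` on three distinct vertices is a 2-tree. [folklore] -/
theorem isTwoTree_triangle {u v w : V} (huv : u ≠ v) (huw : u ≠ w) (hvw : v ≠ w) :
    IsTwoTree ({s(u, v)} ∪ {s(u, w), s(w, v)} : Set (Sym2 V)) := by
  refine IsTwoTree.cons (IsTwoTree.pair huv) (Set.mem_singleton _) ?_
  intro e he
  rw [Set.mem_singleton_iff] at he
  subst he
  rw [Sym2.mem_iff]; rintro (h | h); exacts [huw h.symm, hvw h.symm]

end FK

end Summit.CriticalPhenomena.PercolationContinuityZ3.Theorems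

end
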